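import Summits.AtomisticToContinuum.HydrodynamicLimit.Theorems.InformationPercolationEnginePercolationClosesChaosDockingAssembly
import Summits.AtomisticToContinuum.HydrodynamicLimit.Theorems.InformationPercolationEnginePercolationClosesChaosDockingMeasurable
import HarnessLib

/-!
# Docking S7 of the line `equilibrium-forecast-chain-rule` (crux `InformationPercolationEngine.PercolationClosesChaos`,
stmt-AtomisticToContinuum-15178) — the registered stub `stub_docking`

Support file (`--supports stmt-AtomisticToContinuum-15178`): the registered stub S7 of the line's skeleton
(`Cruxes/PercolationClosesChaos/Lines/equilibrium_forecast_chain_rule.lean`),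
`stub_docking : KineticCellChaosLG → NoMesoscopicOscillation → LocalCountUI → ContactChaos`, with the registered signature
verbatim, as the composition of the probabilistic assembly `docking_of_aemeasurable` (piece G, worker S7-main) with the two
a.e.-measurability facts `aemeasurable_unitAvg_badWeight`, `aemeasurable_unitAvg_rowCount_trunc` (worker S7-M). Pieces:
A `…DockingTarget` (the target's `let`-block defect is `dockDefect`), B `…DockingReplace` (per-collision replacement),
C `…DockingOwners` (cross-ratio defect by owner), E `…DockingTiling` (time tiling, unit-average dictionary), F0/F0'
`…DockingBudget`/`…DockingBudgetOrder` (smallness budget), F1 `…DockingDisplacement` (in-step path lengths against the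
energy), F2 `…DockingStep`/`…DockingDeterministic` (deterministic bound on a good orbit), G `…DockingAssembly` (Markov, union
bound, `measure_contactDefect_le`), M `…DockingMeasurable` (a.e.-measurability of the averaged statistics).
-/

noncomputable section

open MeasureTheory Set Filter Topology
open scoped ENNReal BigOperators Classical
open Literature.Analysis.FluidPDE Literature.MathematicalPhysics.KineticTheory
open Literature.MathematicalPhysics.KineticTheory.VelocityBlindPlacement

namespace Summit.AtomisticToContinuum.HydrodynamicLimit.Theorems.EquilibriumForecastLine

/-- **Registered stub S7 `stub_docking` of the line `equilibrium-forecast-chain-rule`: the kinetic docking.** Kinetic-cell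
chaos under the evolved law (`KineticCellChaosLG`, the output of the forecast transfer S6), no mesoscopic oscillation between
the kinetic cell and the `r`-ball (`NoMesoscopicOscillation`) and local uniform integrability of the kinetic collision counts
(`LocalCountUI`) imply the route target `ContactChaos` (averaged molecular chaos at contact: the cross-ratio defect of the
empirical collision measure against the `r`-mollified pair fields is small in `localGibbsLaw`-probability, `N → ∞` then
`r → 0`). [folklore] -/
theorem stub_docking : KineticCellChaosLG → NoMesoscopicOscillation → LocalCountUI → Summit.AtomisticToContinuum.HydrodynamicLimit.Theses.InformationPercolationEngine.ContactChaos :=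
  docking_of_aemeasurable @aemeasurable_unitAvg_badWeight @aemeasurable_unitAvg_rowCount_trunc

end Summit.AtomisticToContinuum.HydrodynamicLimit.Theorems.EquilibriumForecastLine

end
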